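/-
Copyright: cell `pub-balaban-gaps` (G2), seat ne6 (row NE7b), `prover-pub-balaban-gaps-ne6-g20-0`. Project licence.
-/
import Summits.QuantumFields.BalabanUV.T4Continuum.Spine.NE7b.CompactFibrePlaquetteMassSU2Limit
import Summits.QuantumFields.BalabanUV.T4Continuum.Spine.NE7b.CompactFibreMeanActionSUNLimit

/-!
# EQUIPARTITION OF FLUCTUATIONS FOR ONE `SU(2)` PLAQUETTE: `β²·⟨(Re tr(1−U))²⟩_β → 15∕4` AND THE SPECIFIC HEAT `β²·Var_β(Re tr(1−U)) → 3∕2 = dim SU(2)∕2`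
# AS `β → ∞` (row NE7b, node U5c; MODEL, [folklore]; census V55 — the second moment of the action under the one-plaquette Wilson weight, Bessel-free)

Cell `pub-balaban-gaps` (G2 spine census) for the `pub-balaban` T⁴ crux NE7b (`T4WeightBudget.RelWeightBound`; NOT PRINTED, NOT PROVED).  Crux-route work under
`Spine/NE7b/`; imports the landed V45 `CompactFibrePlaquetteMassSU2Limit` (`tendsto_mul_sin_sq_div_sqrt`, `tendsto_two_mul_mul_one_sub_cos_div_sqrt`,
`tendsto_scaled_plaquetteMass_SU2`; it re-exports V40e's `integral_haar_su2_classFun`, V41's `explicit_le_plaquetteMass_SU2` and J1's `re_trace_one_sub_eq`) and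
V49 `CompactFibreMeanActionSUNLimit` (`tendsto_mul_meanAction_SU2`: `β⟨s⟩_β → 3∕2`) + Mathlib (dominated convergence, `integral_rpow_mul_exp_neg_mul_rpow`, Jordan's
`Real.cos_le_one_sub_mul_cos_sq`, `Real.one_sub_sq_div_two_le_cos`, `Real.sin_le`); no `def`, zero `sorry`, nothing of Bałaban's asserted.

THE LOCATED QUESTION.  V49∕J4 proved EQUIPARTITION `β⟨s⟩_β → 3∕2` (`s = Re tr(1 − U)`, one `SU(2)` plaquette under `e^{−βs}dHaar∕Z(β)`; `(N²−1)∕2` for every N), V51 the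
reference state's variance, V50 that `−log Z` is concave (`Var_β(s) ≥ 0` is its curvature).  QUESTION (V55): the SECOND MOMENT and the VARIANCE of the action under
the tilted weight at weak coupling — does the one-plaquette «specific heat» `β²·Var_β(s)` take the Gaussian value `dim SU(2)∕2 = 3∕2` in the limit?  ANSWER ([folklore];
`Z(β) = ∫ e^{−βs} dHaar`, `M(β) = ∫ s·e^{−βs} dHaar`, `W(β) = ∫ s²·e^{−βs} dHaar`, `B(β) = ∫_{(0,π)} e^{−2β(1−cos ψ)}(1 − cos ψ)² sin²ψ dψ`):
* §1 **`integral_pow_six_exp_neg_sq_Ioi`**: `∫₀^∞ u⁶e^{−u²} du = 15√π∕16`; **`tendsto_rescaled_sqDeficit_sin_sq_integrand`**: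
  `β³·e^{−2β(1−cos(u∕√β))}(1 − cos(u∕√β))² sin²(u∕√β) → (u⁶∕4)e^{−u²}`;
* §2 **`scaled_sqDeficit_sin_sq_integral_eq_integral_Ioi`** (`β > 0`): `(√β)⁷·B(β) = ∫_{(0,∞)} 𝟙_{(0,π√β]}(u)·β³·e^{−2β(1−cos(u∕√β))}(1 − cos(u∕√β))² sin²(u∕√β) du`;
* §3 **`tendsto_scaled_sqDeficit_sin_sq_integral`**: `(√β)⁷·B(β) → 15√π∕64` — DOMINATED CONVERGENCE, majorant `(u⁶∕4)·e^{−(4∕π²)u²}` (`2β(1 − cos x) ≤ βx²`, `β sin²x ≤ βx²`, Jordan);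
* §4 (Haar currency) **`integral_sq_traceDeficit_mul_exp_eq`** (`β ≥ 0`): `W(β) = (2∕π)·∫_{(0,π)} 4(1 − cos ψ)²·e^{−2β(1−cos ψ)} sin²ψ dψ` (Weyl, V40e's class-function formula; `Z > 0` from V41's explicit floor);
* §5 **`tendsto_sq_mul_secondMoment_SU2`**: `β²·W(β)∕Z(β) → 15∕4` (`= (8∕π)·(15√π∕64)·(2√π)`: the second moment of `½χ²₃`);
* §6 **`tendsto_sq_mul_actionVariance_SU2`**: `β²·(W(β)∕Z(β) − (M(β)∕Z(β))²) → 15∕4 − (3∕2)² = 3∕2` — EQUIPARTITION OF FLUCTUATIONS: the one-plaquette specific heat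
  `β²·Var_β(Re tr(1−U))` tends to `dim SU(2)∕2` (three Gaussian modes, `½` each), with V49's `β⟨s⟩_β → 3∕2` for the square of the mean;
  **`eventually_actionVariance_SU2_window`**: for every `ε > 0`, eventually `(3∕2 − ε)∕β² < Var_β(s) < (3∕2 + ε)∕β²` (so `Var_β(s) > 0` with the Gaussian size).

HONEST REMARKS.  (i) MODEL ∕ [folklore]: Haar calculus of ONE `SU(2)` plaquette variable; nothing of the interacting measure.  (ii) N = 2 only (the all-N statement
`β²Var_β → (N²−1)∕2` would follow from ne8's window constant by the layer-cake route of V48∕V49; not done here).  (iii) The identification `Var_β(s) = (log Z)″(β)` (second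
parametric differentiation) is NOT proved here; only the moments' limits.  (iv) (A3) ∕ (A1c) NOT asserted; NC-NE7b-α UNRULED.  BY-NAME EFFECT ON THE WALL: NONE.  NE7b NOT
PRINTED ∕ NOT PROVED; spine PROVED 0∕9; rung (B)+1 on ONE finite T⁴ — NOT infinite volume, NOT the mass gap, NOT Clay.
HONEST DEPENDENCY: continuum YM on T⁴ ⇐ BetaPertH ∧ nine spine estimates (0/9 proved); BetaPertH ⇐ (D1) ∧ (D4) ∧ CAP+tail;
G-an2-4 gates asym, D1 and NE2/3/4.  This file changes none of it.
-/

set_option autoImplicit false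

noncomputable section

open Real Set MeasureTheory Filter Topology
open Literature.MathematicalPhysics.QuantumFieldTheory (haarProbability)
open Summit.QuantumFields.BalabanUV.T4Continuum.NE7b.CompactFibreWindowSU2DoublingHaar (re_trace_one_sub_eq abs_re_trace_le_two)
open Summit.QuantumFields.BalabanUV.T4Continuum.NE7b.CompactFibreSU2ClassIntegral (integral_exp_neg_traceDeficit_eq integral_haar_su2_classFun)
open Summit.QuantumFields.BalabanUV.T4Continuum.NE7b.CompactFibrePlaquetteMassSU2Explicit (explicit_le_plaquetteMass_SU2)
open Summit.QuantumFields.BalabanUV.T4Continuum.NE7b.CompactFibrePlaquetteMassSU2Limit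
  (tendsto_mul_sin_sq_div_sqrt tendsto_two_mul_mul_one_sub_cos_div_sqrt tendsto_scaled_plaquetteMass_SU2)
open Summit.QuantumFields.BalabanUV.T4Continuum.NE7b.CompactFibreMeanActionSUNLimit (tendsto_mul_meanAction_SU2)

namespace Summit.QuantumFields.BalabanUV.T4Continuum.NE7b.CompactFibreActionVarianceSU2

/-! ### §1 The sixth Gaussian moment and the pointwise limit -/

/-- `∫₀^∞ u⁶e^{−u²} du = 15√π∕16` (`= ½·Γ(7∕2)`). [folklore] -/
theorem integral_pow_six_exp_neg_sq_Ioi :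
    ∫ u in Set.Ioi (0 : ℝ), u ^ 6 * Real.exp (-u ^ 2) = 15 * Real.sqrt Real.pi / 16 := by
  have h := integral_rpow_mul_exp_neg_mul_rpow (p := 2) (q := 6) two_pos (by norm_num) one_pos
  have e : ∀ x ∈ Set.Ioi (0 : ℝ), x ^ (6 : ℝ) * Real.exp (-1 * x ^ (2 : ℝ)) = x ^ 6 * Real.exp (-x ^ 2) := by
    intro x _
    rw [show (6 : ℝ) = ((6 : ℕ) : ℝ) by norm_num, show (2 : ℝ) = ((2 : ℕ) : ℝ) by norm_num, Real.rpow_natCast,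
      Real.rpow_natCast, neg_mul, one_mul]
  rw [setIntegral_congr_fun measurableSet_Ioi e] at h
  have hG : Real.Gamma (((6 : ℝ) + 1) / 2) = 15 / 8 * Real.sqrt Real.pi := by
    rw [show ((6 : ℝ) + 1) / 2 = 1 / 2 + 1 + 1 + 1 by norm_num, Real.Gamma_add_one (by norm_num : (1 : ℝ) / 2 + 1 + 1 ≠ 0),
      Real.Gamma_add_one (by norm_num : (1 : ℝ) / 2 + 1 ≠ 0), Real.Gamma_add_one (by norm_num : (1 : ℝ) / 2 ≠ 0), Real.Gamma_one_half_eq]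
    ring
  rw [h, Real.one_rpow, hG]
  ring

/-- `u⁶e^{−bu²}` is integrable on `ℝ` for `b > 0`. [folklore] -/
theorem integrable_pow_six_mul_exp_neg_mul_sq {b : ℝ} (hb : 0 < b) :
    Integrable (fun u : ℝ => u ^ 6 * Real.exp (-b * u ^ 2)) := by
  have h := integrable_rpow_mul_exp_neg_mul_sq hb (s := 6) (by norm_num)
  refine h.congr (ae_of_all _ fun u => ?_)
  show u ^ (6 : ℝ) * Real.exp (-b * u ^ 2) = u ^ 6 * Real.exp (-b * u ^ 2)
  rw [show (6 : ℝ) = ((6 : ℕ) : ℝ) by norm_num, Real.rpow_natCast]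

/-- **The pointwise limit of the rescaled integrand**: for every `u ≥ 0`,
`β³·(e^{−2β(1−cos(u∕√β))}·(1 − cos(u∕√β))²·sin²(u∕√β)) → (u⁶∕4)·e^{−u²}` (V45's two pointwise limits). [folklore] -/
theorem tendsto_rescaled_sqDeficit_sin_sq_integrand {u : ℝ} (hu : 0 ≤ u) :
    Tendsto (fun β : ℝ => β ^ 3 * (Real.exp (-(2 * β * (1 - Real.cos (u / Real.sqrt β)))) * (1 - Real.cos (u / Real.sqrt β)) ^ 2
        * Real.sin (u / Real.sqrt β) ^ 2)) atTop (𝓝 (u ^ 6 / 4 * Real.exp (-u ^ 2))) := by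
  have h1 := tendsto_two_mul_mul_one_sub_cos_div_sqrt u
  have h2 : Tendsto (fun β : ℝ => Real.exp (-(2 * β * (1 - Real.cos (u / Real.sqrt β))))) atTop (𝓝 (Real.exp (-u ^ 2))) :=
    (Real.continuous_exp.tendsto _).comp h1.neg
  have h3 := tendsto_mul_sin_sq_div_sqrt hu
  have h := (((h1.pow 2).mul h2).mul h3).const_mul (1 / 4)
  have e1 : (1 / 4 : ℝ) * ((u ^ 2) ^ 2 * Real.exp (-u ^ 2) * u ^ 2) = u ^ 6 / 4 * Real.exp (-u ^ 2) := by ring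
  rw [e1] at h
  refine h.congr fun β => ?_
  ring

/-! ### §2 The substitution `ψ = u∕√β` -/

/-- **`(√β)⁷·B(β)` AS AN INTEGRAL OVER `(0, ∞)`**: for `β > 0`,
`(√β)⁷·∫_{(0,π)} e^{−2β(1−cos ψ)}(1 − cos ψ)² sin²ψ dψ = ∫_{(0,∞)} 𝟙_{(0,π√β]}(u)·β³·e^{−2β(1−cos(u∕√β))}(1 − cos(u∕√β))² sin²(u∕√β) du`. [folklore] -/
theorem scaled_sqDeficit_sin_sq_integral_eq_integral_Ioi {β : ℝ} (hβ : 0 < β) :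
    Real.sqrt β ^ 7 * ∫ ψ in Set.Ioo 0 Real.pi, Real.exp (-(2 * β * (1 - Real.cos ψ))) * (1 - Real.cos ψ) ^ 2 * Real.sin ψ ^ 2
      = ∫ u in Set.Ioi (0 : ℝ), (Set.Ioc 0 (Real.pi * Real.sqrt β)).indicator
          (fun u => β ^ 3 * (Real.exp (-(2 * β * (1 - Real.cos (u / Real.sqrt β)))) * (1 - Real.cos (u / Real.sqrt β)) ^ 2
            * Real.sin (u / Real.sqrt β) ^ 2)) u := by
  have hπ := Real.pi_pos
  have hs : 0 < Real.sqrt β := Real.sqrt_pos.2 hβ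
  have hs2 : Real.sqrt β ^ 2 = β := Real.sq_sqrt hβ.le
  have hsub := intervalIntegral.integral_comp_div (a := 0) (b := Real.pi * Real.sqrt β)
    (fun ψ : ℝ => Real.exp (-(2 * β * (1 - Real.cos ψ))) * (1 - Real.cos ψ) ^ 2 * Real.sin ψ ^ 2) hs.ne'
  rw [zero_div, mul_div_cancel_right₀ _ hs.ne', smul_eq_mul] at hsub
  have hG : ∫ ψ in Set.Ioo 0 Real.pi, Real.exp (-(2 * β * (1 - Real.cos ψ))) * (1 - Real.cos ψ) ^ 2 * Real.sin ψ ^ 2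
      = (Real.sqrt β)⁻¹ * ∫ u in (0 : ℝ)..Real.pi * Real.sqrt β,
          Real.exp (-(2 * β * (1 - Real.cos (u / Real.sqrt β)))) * (1 - Real.cos (u / Real.sqrt β)) ^ 2 * Real.sin (u / Real.sqrt β) ^ 2 := by
    rw [hsub, ← mul_assoc, inv_mul_cancel₀ hs.ne', one_mul, intervalIntegral.integral_of_le hπ.le, integral_Ioc_eq_integral_Ioo]
  rw [hG, setIntegral_indicator measurableSet_Ioc, Set.inter_eq_right.2 Set.Ioc_subset_Ioi_self,
    ← intervalIntegral.integral_of_le (by positivity), intervalIntegral.integral_const_mul, ← mul_assoc]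
  congr 1
  rw [pow_succ, mul_assoc, mul_inv_cancel₀ hs.ne', mul_one, show (6 : ℕ) = 2 * 3 from rfl, pow_mul, hs2]

/-! ### §3 Dominated convergence: `(√β)⁷·B(β) → 15√π∕64` -/

/-- **THE LAPLACE LIMIT OF THE DEFICIT's SECOND MOMENT AGAINST WEYL's DENSITY**: `(√β)⁷·∫_{(0,π)} e^{−2β(1−cos ψ)}(1 − cos ψ)² sin²ψ dψ → ∫₀^∞ (u⁶∕4)e^{−u²} du = 15√π∕64`
(dominated convergence after `ψ = u∕√β`; majorant `(u⁶∕4)·e^{−(4∕π²)u²}`). [folklore] -/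
theorem tendsto_scaled_sqDeficit_sin_sq_integral :
    Tendsto (fun β : ℝ => Real.sqrt β ^ 7 * ∫ ψ in Set.Ioo 0 Real.pi, Real.exp (-(2 * β * (1 - Real.cos ψ))) * (1 - Real.cos ψ) ^ 2 * Real.sin ψ ^ 2)
      atTop (𝓝 (15 * Real.sqrt Real.pi / 64)) := by
  have hπ := Real.pi_pos
  set F : ℝ → ℝ → ℝ := fun β u => (Set.Ioc 0 (Real.pi * Real.sqrt β)).indicator
    (fun u => β ^ 3 * (Real.exp (-(2 * β * (1 - Real.cos (u / Real.sqrt β)))) * (1 - Real.cos (u / Real.sqrt β)) ^ 2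
      * Real.sin (u / Real.sqrt β) ^ 2)) u with hF
  have hcont : ∀ β : ℝ, Continuous fun u : ℝ => β ^ 3 * (Real.exp (-(2 * β * (1 - Real.cos (u / Real.sqrt β)))) * (1 - Real.cos (u / Real.sqrt β)) ^ 2
      * Real.sin (u / Real.sqrt β) ^ 2) := fun β => by fun_prop
  have hF_meas : ∀ᶠ β in atTop, AEStronglyMeasurable (F β) (volume.restrict (Set.Ioi (0 : ℝ))) :=
    Filter.Eventually.of_forall fun β => ((hcont β).aestronglyMeasurable).indicator measurableSet_Ioc
  have h_bound : ∀ᶠ β in atTop, ∀ᵐ u ∂(volume.restrict (Set.Ioi (0 : ℝ))), ‖F β u‖ ≤ u ^ 6 / 4 * Real.exp (-(4 / Real.pi ^ 2) * u ^ 2) := by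
    filter_upwards [eventually_gt_atTop (0 : ℝ)] with β hβ
    refine ae_of_all _ fun u => ?_
    have hs : 0 < Real.sqrt β := Real.sqrt_pos.2 hβ
    have hs2 : Real.sqrt β ^ 2 = β := Real.sq_sqrt hβ.le
    by_cases hu : u ∈ Set.Ioc 0 (Real.pi * Real.sqrt β)
    · have hψ0 : 0 ≤ u / Real.sqrt β := div_nonneg hu.1.le hs.le
      have hψπ : u / Real.sqrt β ≤ Real.pi := (div_le_iff₀ hs).2 hu.2
      have hx2 : (u / Real.sqrt β) ^ 2 = u ^ 2 / β := by rw [div_pow, hs2]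
      have hc0 : 0 ≤ 2 * β * (1 - Real.cos (u / Real.sqrt β)) := by
        have : 0 ≤ 1 - Real.cos (u / Real.sqrt β) := by linarith [Real.cos_le_one (u / Real.sqrt β)]
        positivity
      have hc1 : 2 * β * (1 - Real.cos (u / Real.sqrt β)) ≤ u ^ 2 := by
        have hcos := Real.one_sub_sq_div_two_le_cos (x := u / Real.sqrt β)
        rw [hx2] at hcos
        have h' : 1 - Real.cos (u / Real.sqrt β) ≤ u ^ 2 / β / 2 := by linarith
        calc 2 * β * (1 - Real.cos (u / Real.sqrt β)) ≤ 2 * β * (u ^ 2 / β / 2) := mul_le_mul_of_nonneg_left h' (by positivity)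
          _ = u ^ 2 := by field_simp
      -- `β sin²x ≤ βx² = u²`
      have hsin0 : 0 ≤ Real.sin (u / Real.sqrt β) := Real.sin_nonneg_of_nonneg_of_le_pi hψ0 hψπ
      have hS0 : 0 ≤ β * Real.sin (u / Real.sqrt β) ^ 2 := by positivity
      have hS1 : β * Real.sin (u / Real.sqrt β) ^ 2 ≤ u ^ 2 := by
        have hsq : Real.sin (u / Real.sqrt β) ^ 2 ≤ (u / Real.sqrt β) ^ 2 := pow_le_pow_left₀ hsin0 (Real.sin_le hψ0) 2
        calc β * Real.sin (u / Real.sqrt β) ^ 2 ≤ β * (u / Real.sqrt β) ^ 2 := mul_le_mul_of_nonneg_left hsq hβ.le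
          _ = u ^ 2 := by rw [hx2]; field_simp
      have hj := Real.cos_le_one_sub_mul_cos_sq (show |u / Real.sqrt β| ≤ Real.pi by rw [abs_of_nonneg hψ0]; exact hψπ)
      rw [hx2] at hj
      have he : Real.exp (-(2 * β * (1 - Real.cos (u / Real.sqrt β)))) ≤ Real.exp (-(4 / Real.pi ^ 2) * u ^ 2) := by
        refine Real.exp_le_exp.2 ?_
        have h' : 2 / Real.pi ^ 2 * (u ^ 2 / β) ≤ 1 - Real.cos (u / Real.sqrt β) := by linarith
        have h2 := mul_le_mul_of_nonneg_left h' (by positivity : (0 : ℝ) ≤ 2 * β)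
        have e : 2 * β * (2 / Real.pi ^ 2 * (u ^ 2 / β)) = 4 / Real.pi ^ 2 * u ^ 2 := by field_simp; ring
        rw [neg_mul]; linarith
      have hsq : (2 * β * (1 - Real.cos (u / Real.sqrt β))) ^ 2 ≤ (u ^ 2) ^ 2 := pow_le_pow_left₀ hc0 hc1 2
      simp only [hF, Set.indicator_of_mem hu, Real.norm_eq_abs]
      rw [abs_of_nonneg (by positivity)]
      calc β ^ 3 * (Real.exp (-(2 * β * (1 - Real.cos (u / Real.sqrt β)))) * (1 - Real.cos (u / Real.sqrt β)) ^ 2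
            * Real.sin (u / Real.sqrt β) ^ 2)
          = (2 * β * (1 - Real.cos (u / Real.sqrt β))) ^ 2 / 4 * (β * Real.sin (u / Real.sqrt β) ^ 2)
              * Real.exp (-(2 * β * (1 - Real.cos (u / Real.sqrt β)))) := by ring
        _ ≤ (u ^ 2) ^ 2 / 4 * u ^ 2 * Real.exp (-(4 / Real.pi ^ 2) * u ^ 2) :=
            mul_le_mul (mul_le_mul (div_le_div_of_nonneg_right hsq (by norm_num)) hS1 hS0 (by positivity)) he (Real.exp_pos _).le
              (by positivity)
        _ = u ^ 6 / 4 * Real.exp (-(4 / Real.pi ^ 2) * u ^ 2) := by ring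
    · simp only [hF, Set.indicator_of_notMem hu, norm_zero]
      positivity
  have hint : Integrable (fun u : ℝ => u ^ 6 / 4 * Real.exp (-(4 / Real.pi ^ 2) * u ^ 2)) (volume.restrict (Set.Ioi (0 : ℝ))) := by
    have h := (integrable_pow_six_mul_exp_neg_mul_sq (by positivity : (0 : ℝ) < 4 / Real.pi ^ 2)).div_const 4
    have h' : Integrable (fun u : ℝ => u ^ 6 / 4 * Real.exp (-(4 / Real.pi ^ 2) * u ^ 2)) :=
      h.congr (ae_of_all _ fun u => by
        show u ^ 6 * Real.exp (-(4 / Real.pi ^ 2) * u ^ 2) / 4 = u ^ 6 / 4 * Real.exp (-(4 / Real.pi ^ 2) * u ^ 2)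
        ring)
    exact h'.restrict
  have h_lim : ∀ᵐ u ∂(volume.restrict (Set.Ioi (0 : ℝ))), Tendsto (fun β => F β u) atTop (𝓝 (1 / 4 * (u ^ 6 * Real.exp (-u ^ 2)))) := by
    refine ae_restrict_of_forall_mem measurableSet_Ioi fun u hu => ?_
    have hu0 : 0 < u := hu
    have hlim := tendsto_rescaled_sqDeficit_sin_sq_integrand hu0.le
    rw [show u ^ 6 / 4 * Real.exp (-u ^ 2) = 1 / 4 * (u ^ 6 * Real.exp (-u ^ 2)) by ring] at hlim
    refine hlim.congr' ?_
    filter_upwards [eventually_ge_atTop ((u / Real.pi) ^ 2), eventually_gt_atTop (0 : ℝ)] with β hβu hβ0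
    have hmem : u ∈ Set.Ioc 0 (Real.pi * Real.sqrt β) := by
      refine ⟨hu0, ?_⟩
      have := Real.le_sqrt_of_sq_le hβu
      rwa [div_le_iff₀' hπ] at this
    simp only [hF, Set.indicator_of_mem hmem]
  have hDCT := tendsto_integral_filter_of_dominated_convergence (fun u : ℝ => u ^ 6 / 4 * Real.exp (-(4 / Real.pi ^ 2) * u ^ 2))
    hF_meas h_bound hint h_lim
  rw [integral_const_mul, integral_pow_six_exp_neg_sq_Ioi, show (1 / 4 : ℝ) * (15 * Real.sqrt Real.pi / 16) = 15 * Real.sqrt Real.pi / 64 by ring] at hDCT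
  refine hDCT.congr' ?_
  filter_upwards [eventually_gt_atTop (0 : ℝ)] with β hβ
  simp only [hF]
  exact (scaled_sqDeficit_sin_sq_integral_eq_integral_Ioi hβ).symm

/-! ### §4 Haar currency: the second moment of the action in Weyl's variable -/

/-- **WEYL FORM OF THE SECOND MOMENT**: for `β ≥ 0`,
`∫ (Re tr(1−U))²·e^{−β·Re tr(1−U)} dHaar_{SU(2)}(U) = (2∕π)·∫_{(0,π)} 4(1 − cos ψ)²·e^{−2β(1−cos ψ)} sin²ψ dψ` (V40e's class-function formula with
`φ(x) = (2 − x)²·e^{−β(2−x)}`, bounded by `16` on `[−2, 2]`). [folklore] -/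
theorem integral_sq_traceDeficit_mul_exp_eq {β : ℝ} (hβ : 0 ≤ β) :
    ∫ U, (Matrix.trace (1 - (U : Matrix (Fin 2) (Fin 2) ℂ))).re ^ 2 * Real.exp (-(β * (Matrix.trace (1 - (U : Matrix (Fin 2) (Fin 2) ℂ))).re))
        ∂(haarProbability (Matrix.specialUnitaryGroup (Fin 2) ℂ))
      = 2 / Real.pi * ∫ ψ in Set.Ioo 0 Real.pi, 4 * (1 - Real.cos ψ) ^ 2 * Real.exp (-(2 * β * (1 - Real.cos ψ))) * Real.sin ψ ^ 2 := by
  have hφm : Measurable fun x : ℝ => (2 - x) ^ 2 * Real.exp (-(β * (2 - x))) :=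
    (((continuous_const.sub continuous_id).pow 2).mul (Real.continuous_exp.comp ((continuous_const.mul (continuous_const.sub continuous_id)).neg))).measurable
  have hφ0 : ∀ x : ℝ, 0 ≤ (2 - x) ^ 2 * Real.exp (-(β * (2 - x))) := fun x => mul_nonneg (sq_nonneg _) (Real.exp_pos _).le
  have hφM : ∀ x : ℝ, -2 ≤ x → x ≤ 2 → (2 - x) ^ 2 * Real.exp (-(β * (2 - x))) ≤ 16 := fun x hx1 hx2 => by
    have h1 : (2 - x) ^ 2 ≤ 16 := by nlinarith
    have h2 : Real.exp (-(β * (2 - x))) ≤ 1 := by rw [Real.exp_le_one_iff]; nlinarith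
    calc (2 - x) ^ 2 * Real.exp (-(β * (2 - x))) ≤ 16 * 1 := mul_le_mul h1 h2 (Real.exp_pos _).le (by norm_num)
      _ = 16 := by norm_num
  have h := integral_haar_su2_classFun (fun x : ℝ => (2 - x) ^ 2 * Real.exp (-(β * (2 - x)))) hφm hφ0 hφM
  have hL : ∀ U : Matrix.specialUnitaryGroup (Fin 2) ℂ,
      (2 - (Matrix.trace (U : Matrix (Fin 2) (Fin 2) ℂ)).re) ^ 2 * Real.exp (-(β * (2 - (Matrix.trace (U : Matrix (Fin 2) (Fin 2) ℂ)).re)))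
        = (Matrix.trace (1 - (U : Matrix (Fin 2) (Fin 2) ℂ))).re ^ 2 * Real.exp (-(β * (Matrix.trace (1 - (U : Matrix (Fin 2) (Fin 2) ℂ))).re)) := fun U => by
    rw [re_trace_one_sub_eq]
  have hR : ∀ ψ : ℝ, (2 - 2 * Real.cos ψ) ^ 2 * Real.exp (-(β * (2 - 2 * Real.cos ψ))) * Real.sin ψ ^ 2
      = 4 * (1 - Real.cos ψ) ^ 2 * Real.exp (-(2 * β * (1 - Real.cos ψ))) * Real.sin ψ ^ 2 := fun ψ => by
    have e1 : (2 - 2 * Real.cos ψ) ^ 2 = 4 * (1 - Real.cos ψ) ^ 2 := by ring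
    have e2 : -(β * (2 - 2 * Real.cos ψ)) = -(2 * β * (1 - Real.cos ψ)) := by ring
    rw [e1, e2]
  simp only [hL] at h
  rw [h]
  congr 1
  exact integral_congr_ae (ae_of_all _ fun ψ => hR ψ)

/-! ### §5 `β²⟨s²⟩_β → 15∕4` -/

/-- **THE SECOND MOMENT OF THE ACTION AT WEAK COUPLING**: `β²·(∫ (Re tr(1−U))² e^{−β Re tr(1−U)} dHaar)∕(∫ e^{−β Re tr(1−U)} dHaar) → 15∕4` as `β → ∞`
(`βs ≈ ½χ²₃`: `E(½χ²₃)² = 15∕4`; `lim = (8∕π)·(15√π∕64)·(2√π)`). [folklore] -/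
theorem tendsto_sq_mul_secondMoment_SU2 :
    Tendsto (fun β : ℝ => β ^ 2 *
        ((∫ U, (Matrix.trace (1 - (U : Matrix (Fin 2) (Fin 2) ℂ))).re ^ 2 * Real.exp (-(β * (Matrix.trace (1 - (U : Matrix (Fin 2) (Fin 2) ℂ))).re))
            ∂(haarProbability (Matrix.specialUnitaryGroup (Fin 2) ℂ)))
          / ∫ U, Real.exp (-(β * (Matrix.trace (1 - (U : Matrix (Fin 2) (Fin 2) ℂ))).re)) ∂(haarProbability (Matrix.specialUnitaryGroup (Fin 2) ℂ))))
      atTop (𝓝 (15 / 4)) := by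
  have hsπ : 0 < Real.sqrt Real.pi := Real.sqrt_pos.2 Real.pi_pos
  have hss : Real.sqrt Real.pi * Real.sqrt Real.pi = Real.pi := Real.mul_self_sqrt Real.pi_pos.le
  have hK : (2 * Real.sqrt Real.pi)⁻¹ ≠ 0 := by positivity
  have h := (tendsto_scaled_sqDeficit_sin_sq_integral.const_mul (8 / Real.pi)).mul (tendsto_scaled_plaquetteMass_SU2.inv₀ hK)
  have e : 8 / Real.pi * (15 * Real.sqrt Real.pi / 64) * ((2 * Real.sqrt Real.pi)⁻¹)⁻¹ = 15 / 4 := by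
    rw [inv_inv]
    field_simp
    nlinarith [hss]
  rw [e] at h
  refine h.congr' ?_
  filter_upwards [eventually_ge_atTop (1 / 4 : ℝ)] with β hβ4
  have hβ : 0 < β := by linarith
  have hsne : Real.sqrt β ≠ 0 := (Real.sqrt_pos.2 hβ).ne'
  have hs2 : Real.sqrt β ^ 2 = β := Real.sq_sqrt hβ.le
  have hZne := (lt_of_lt_of_le (by positivity) (explicit_le_plaquetteMass_SU2 hβ4)).ne'
  have hπne : Real.pi ≠ 0 := Real.pi_pos.ne'
  rw [integral_sq_traceDeficit_mul_exp_eq hβ.le]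
  have e7 : Real.sqrt β ^ 7 = β ^ 2 * Real.sqrt β ^ 3 := by
    rw [show (7 : ℕ) = 2 * 2 + 3 from rfl, pow_add, pow_mul, hs2]
  have e4 : ∫ ψ in Set.Ioo 0 Real.pi, 4 * (1 - Real.cos ψ) ^ 2 * Real.exp (-(2 * β * (1 - Real.cos ψ))) * Real.sin ψ ^ 2
      = 4 * ∫ ψ in Set.Ioo 0 Real.pi, Real.exp (-(2 * β * (1 - Real.cos ψ))) * (1 - Real.cos ψ) ^ 2 * Real.sin ψ ^ 2 := by
    rw [← integral_const_mul]
    exact integral_congr_ae (ae_of_all _ fun ψ => by ring)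
  rw [e4, e7]
  field_simp
  ring

/-! ### §6 The specific heat: `β²·Var_β(s) → 3∕2` -/

/-- **EQUIPARTITION OF FLUCTUATIONS**: with `Z = ∫e^{−βs}dHaar`, `M = ∫s·e^{−βs}dHaar`, `W = ∫s²·e^{−βs}dHaar` (`s = Re tr(1−U)`, one `SU(2)` plaquette),
`β²·(W∕Z − (M∕Z)²) → 3∕2` as `β → ∞` — the one-plaquette specific heat `β²·Var_β(s)` tends to `dim SU(2)∕2` (§5 and V49's `β·M∕Z → 3∕2`). [folklore] -/
theorem tendsto_sq_mul_actionVariance_SU2 :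
    Tendsto (fun β : ℝ => β ^ 2 *
        ((∫ U, (Matrix.trace (1 - (U : Matrix (Fin 2) (Fin 2) ℂ))).re ^ 2 * Real.exp (-(β * (Matrix.trace (1 - (U : Matrix (Fin 2) (Fin 2) ℂ))).re))
            ∂(haarProbability (Matrix.specialUnitaryGroup (Fin 2) ℂ)))
          / (∫ U, Real.exp (-(β * (Matrix.trace (1 - (U : Matrix (Fin 2) (Fin 2) ℂ))).re)) ∂(haarProbability (Matrix.specialUnitaryGroup (Fin 2) ℂ)))
        - ((∫ U, (Matrix.trace (1 - (U : Matrix (Fin 2) (Fin 2) ℂ))).re * Real.exp (-(β * (Matrix.trace (1 - (U : Matrix (Fin 2) (Fin 2) ℂ))).re))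
              ∂(haarProbability (Matrix.specialUnitaryGroup (Fin 2) ℂ)))
            / ∫ U, Real.exp (-(β * (Matrix.trace (1 - (U : Matrix (Fin 2) (Fin 2) ℂ))).re)) ∂(haarProbability (Matrix.specialUnitaryGroup (Fin 2) ℂ))) ^ 2))
      atTop (𝓝 (3 / 2)) := by
  have h := tendsto_sq_mul_secondMoment_SU2.sub (tendsto_mul_meanAction_SU2.pow 2)
  rw [show (15 / 4 : ℝ) - (3 / 2) ^ 2 = 3 / 2 by norm_num] at h
  refine h.congr fun β => ?_
  ring

/-- **EVENTUALLY A TWO-SIDED WINDOW FOR THE VARIANCE**: for every `ε > 0` and all large `β`, `(3∕2 − ε)∕β² < W∕Z − (M∕Z)² < (3∕2 + ε)∕β²` — in particular the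
variance of the action under the tilted weight is eventually POSITIVE with the Gaussian size `3∕(2β²)`. [folklore] -/
theorem eventually_actionVariance_SU2_window {ε : ℝ} (hε : 0 < ε) :
    ∀ᶠ β : ℝ in atTop,
      (3 / 2 - ε) / β ^ 2 <
          (∫ U, (Matrix.trace (1 - (U : Matrix (Fin 2) (Fin 2) ℂ))).re ^ 2 * Real.exp (-(β * (Matrix.trace (1 - (U : Matrix (Fin 2) (Fin 2) ℂ))).re))
              ∂(haarProbability (Matrix.specialUnitaryGroup (Fin 2) ℂ)))
            / (∫ U, Real.exp (-(β * (Matrix.trace (1 - (U : Matrix (Fin 2) (Fin 2) ℂ))).re)) ∂(haarProbability (Matrix.specialUnitaryGroup (Fin 2) ℂ)))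
          - ((∫ U, (Matrix.trace (1 - (U : Matrix (Fin 2) (Fin 2) ℂ))).re * Real.exp (-(β * (Matrix.trace (1 - (U : Matrix (Fin 2) (Fin 2) ℂ))).re))
                ∂(haarProbability (Matrix.specialUnitaryGroup (Fin 2) ℂ)))
              / ∫ U, Real.exp (-(β * (Matrix.trace (1 - (U : Matrix (Fin 2) (Fin 2) ℂ))).re)) ∂(haarProbability (Matrix.specialUnitaryGroup (Fin 2) ℂ))) ^ 2
      ∧ (∫ U, (Matrix.trace (1 - (U : Matrix (Fin 2) (Fin 2) ℂ))).re ^ 2 * Real.exp (-(β * (Matrix.trace (1 - (U : Matrix (Fin 2) (Fin 2) ℂ))).re))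
              ∂(haarProbability (Matrix.specialUnitaryGroup (Fin 2) ℂ)))
            / (∫ U, Real.exp (-(β * (Matrix.trace (1 - (U : Matrix (Fin 2) (Fin 2) ℂ))).re)) ∂(haarProbability (Matrix.specialUnitaryGroup (Fin 2) ℂ)))
          - ((∫ U, (Matrix.trace (1 - (U : Matrix (Fin 2) (Fin 2) ℂ))).re * Real.exp (-(β * (Matrix.trace (1 - (U : Matrix (Fin 2) (Fin 2) ℂ))).re))
                ∂(haarProbability (Matrix.specialUnitaryGroup (Fin 2) ℂ)))
              / ∫ U, Real.exp (-(β * (Matrix.trace (1 - (U : Matrix (Fin 2) (Fin 2) ℂ))).re)) ∂(haarProbability (Matrix.specialUnitaryGroup (Fin 2) ℂ))) ^ 2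
        < (3 / 2 + ε) / β ^ 2 := by
  have h := tendsto_sq_mul_actionVariance_SU2
  have hlo := h.eventually_const_lt (show (3 : ℝ) / 2 - ε < 3 / 2 by linarith)
  have hhi := h.eventually_lt_const (show (3 : ℝ) / 2 < 3 / 2 + ε by linarith)
  filter_upwards [hlo, hhi, eventually_gt_atTop (0 : ℝ)] with β h1 h2 hβ
  have hβ2 : 0 < β ^ 2 := by positivity
  constructor
  · rw [div_lt_iff₀ hβ2]; linarith
  · rw [lt_div_iff₀ hβ2]; linarith

end Summit.QuantumFields.BalabanUV.T4Continuum.NE7b.CompactFibreActionVarianceSU2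

end
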